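import Summits.Ventures.LatticeQCDFlow.Scoring.SU2TorusPlaquettePairTerm
import HarnessLib

/-!
# SU(2) on the 2-torus: the two-plaquette insertion `∫ a₀(U_p) a₀(U_q) e^{−βS} dHaar^{⊗E}` as a series over `ℕ`

HONEST FRAMING: exact (Metropolis-corrected) sampling algorithms for lattice gauge theory;
figures of merit are autocorrelation/cost numbers at stated couplings and volumes; no
continuum-physics claim.

Venture `LatticeQCDFlow` (cell pub-lqcd), sub-topic `Scoring`; FANOUT row 5 (`s0-sun-a`), GEN-12.
NEW WORK of the cell (placement rule).  From the doubly-inserted character integral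
(`SU2TorusPlaquettePairCharacterIntegral`) only four families of assignments survive (`x ≡ n+1` off `{p,q}`
with `(x_p, x_q) ∈ {(n,n), (n+2,n), (n,n+2)}`, and `x ≡ n` off `{p,q}` with `x_p = x_q = n+1`); with
`c_n(β) = e^{−2β}(I_n(2β) − I_{n+2}(2β))`:

* **`hasSum_integral_su2a0_pair_mul_exp_neg_wilsonAction_two`** — for `β ≥ 0` and `p ≠ q`:
  `∫ a₀(U_p) a₀(U_q) e^{−βS} dHaar^{⊗E} = ¼ Σ_n [c_n² c_{n+1}^{L²−2}/(n+2)^{L²} + 2 c_n c_{n+2} c_{n+1}^{L²−2}/(n+2)^{L²}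
  + c_{n+1}² c_n^{L²−2}/(n+1)^{L²}]`.

The exact pair correlation `⟨½ tr U_p · ½ tr U_q⟩` and its finite-volume analysis follow in
`SU2TorusPlaquettePairFiniteVolume`.  Nothing is cited; no `def`.
-/

noncomputable section

open Real MeasureTheory Set Function Finset Polynomial.Chebyshev
open Literature.MathematicalPhysics.QuantumFieldTheory Literature.MathematicalPhysics.QuantumLattice
open Literature.Analysis.FunctionSpaces
open Summit.Ventures.LatticeQCDFlow.Exactness
open Summit.Ventures.LatticeQCDFlow.Theory2.Lattice

namespace Summit.Ventures.LatticeQCDFlow.Scoring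

variable {L : ℕ} [NeZero L]

/-! ## §2. The pair insertion as a series over `ℕ` -/

/-- **`∫ a₀(U_{x₀}) a₀(U_{y₀}) e^{−βS} dHaar^{⊗E} = ¼ Σ_n [c_n² c_{n+1}^{L²−2}/(n+2)^{L²} + 2 c_n c_{n+2} c_{n+1}^{L²−2}/(n+2)^{L²}
+ c_{n+1}² c_n^{L²−2}/(n+1)^{L²}]`** (`β ≥ 0`, `x₀ ≠ y₀`, `c_n = e^{−2β}(I_n(2β) − I_{n+2}(2β))`), as a `HasSum`. -/
theorem hasSum_integral_su2a0_pair_mul_exp_neg_wilsonAction_two {β : ℝ} (hβ : 0 ≤ β) {x₀ y₀ : Site 2 L}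
    (hxy : x₀ ≠ y₀) :
    HasSum (fun n : ℕ => (1 / 4) *
        ((Real.exp (-(2 * β)) * (besselI n (2 * β) - besselI (n + 2) (2 * β))) ^ 2 *
            (Real.exp (-(2 * β)) * (besselI (n + 1) (2 * β) - besselI (n + 1 + 2) (2 * β))) ^ (L ^ 2 - 2) *
            ((((n : ℝ) + 1 + 1) ^ (L ^ 2)))⁻¹ +
          2 * ((Real.exp (-(2 * β)) * (besselI n (2 * β) - besselI (n + 2) (2 * β))) *
            (Real.exp (-(2 * β)) * (besselI (n + 2) (2 * β) - besselI (n + 2 + 2) (2 * β))) *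
            (Real.exp (-(2 * β)) * (besselI (n + 1) (2 * β) - besselI (n + 1 + 2) (2 * β))) ^ (L ^ 2 - 2) *
            ((((n : ℝ) + 1 + 1) ^ (L ^ 2)))⁻¹) +
          (Real.exp (-(2 * β)) * (besselI (n + 1) (2 * β) - besselI (n + 1 + 2) (2 * β))) ^ 2 *
            (Real.exp (-(2 * β)) * (besselI n (2 * β) - besselI (n + 2) (2 * β))) ^ (L ^ 2 - 2) *
            ((((n : ℝ) + 1) ^ (L ^ 2)))⁻¹))
      (∫ V, su2a0 (plaquetteHolonomy V x₀ 0 1) * su2a0 (plaquetteHolonomy V y₀ 0 1) *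
          Real.exp (-β * wilsonAction (fundamentalRep (Fin 2)) V)
        ∂(Measure.pi fun _ : Edge 2 L => haarProbability (Matrix.specialUnitaryGroup (Fin 2) ℂ))) := by
  haveI := secondCountableTopology_su2
  obtain ⟨hsum, hN⟩ := integral_obs_mul_exp_neg_wilsonAction_eq_tsum (L := L) hβ
    (fun V : GaugeConfig 2 L (Matrix.specialUnitaryGroup (Fin 2) ℂ) =>
      su2a0 (plaquetteHolonomy V x₀ 0 1) * su2a0 (plaquetteHolonomy V y₀ 0 1))
    (continuous_su2a0_pair_plaquette x₀ y₀).measurable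
    (fun V => by
      rw [abs_mul]
      exact mul_le_one₀ (abs_su2a0_le_one _) (abs_nonneg _) (abs_su2a0_le_one _))
  -- abbreviations: the plane, the two observed plaquettes, the coefficients
  set pl : {p : Fin 2 × Fin 2 // p.1 < p.2} := ⟨((0 : Fin 2), (1 : Fin 2)), by decide⟩ with hpl
  set p₀ : Plaquette 2 L := (x₀, pl) with hp₀
  set q₀ : Plaquette 2 L := (y₀, pl) with hq₀
  have hpq : p₀ ≠ q₀ := fun h => hxy (congrArg Prod.fst h)
  set c : ℕ → ℝ := fun n => Real.exp (-(2 * β)) * (besselI n (2 * β) - besselI (n + 2) (2 * β)) with hc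
  have hc0 : ∀ n, 0 ≤ c n := fun n => charCoeff_nonneg hβ n
  -- the four surviving families of terms
  set T1 : (Plaquette 2 L → ℕ) → ℝ := fun x => (∏ p, c (x p)) * ((1 / 4) *
    (if (∀ s : Site 2 L, update (update (fun s : Site 2 L => x (s, pl)) y₀ (x q₀ + 1)) x₀ (x p₀ + 1) s =
        update (update (fun s : Site 2 L => x (s, pl)) y₀ (x q₀ + 1)) x₀ (x p₀ + 1) 0) then
      ((((update (update (fun s : Site 2 L => x (s, pl)) y₀ (x q₀ + 1)) x₀ (x p₀ + 1) 0 : ℝ) + 1) ^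
        (L ^ 2)))⁻¹ else 0)) with hT1
  set T2 : (Plaquette 2 L → ℕ) → ℝ := fun x => (∏ p, c (x p)) * ((1 / 4) *
    (if x p₀ = 0 then 0 else
      if (∀ s : Site 2 L, update (update (fun s : Site 2 L => x (s, pl)) y₀ (x q₀ + 1)) x₀ (x p₀ - 1) s =
          update (update (fun s : Site 2 L => x (s, pl)) y₀ (x q₀ + 1)) x₀ (x p₀ - 1) 0) then
        ((((update (update (fun s : Site 2 L => x (s, pl)) y₀ (x q₀ + 1)) x₀ (x p₀ - 1) 0 : ℝ) + 1) ^
          (L ^ 2)))⁻¹ else 0)) with hT2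
  set T3 : (Plaquette 2 L → ℕ) → ℝ := fun x => (∏ p, c (x p)) * ((1 / 4) *
    (if x q₀ = 0 then 0 else
      if (∀ s : Site 2 L, update (update (fun s : Site 2 L => x (s, pl)) y₀ (x q₀ - 1)) x₀ (x p₀ + 1) s =
          update (update (fun s : Site 2 L => x (s, pl)) y₀ (x q₀ - 1)) x₀ (x p₀ + 1) 0) then
        ((((update (update (fun s : Site 2 L => x (s, pl)) y₀ (x q₀ - 1)) x₀ (x p₀ + 1) 0 : ℝ) + 1) ^
          (L ^ 2)))⁻¹ else 0)) with hT3
  set T4 : (Plaquette 2 L → ℕ) → ℝ := fun x => (∏ p, c (x p)) * ((1 / 4) *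
    (if x q₀ = 0 then 0 else if x p₀ = 0 then 0 else
      if (∀ s : Site 2 L, update (update (fun s : Site 2 L => x (s, pl)) y₀ (x q₀ - 1)) x₀ (x p₀ - 1) s =
          update (update (fun s : Site 2 L => x (s, pl)) y₀ (x q₀ - 1)) x₀ (x p₀ - 1) 0) then
        ((((update (update (fun s : Site 2 L => x (s, pl)) y₀ (x q₀ - 1)) x₀ (x p₀ - 1) 0 : ℝ) + 1) ^
          (L ^ 2)))⁻¹ else 0)) with hT4
  have hT : ∀ x : Plaquette 2 L → ℕ,
      (∏ p, Real.exp (-(2 * β)) * (besselI (x p) (2 * β) - besselI (x p + 2) (2 * β))) *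
      ∫ V, su2a0 (plaquetteHolonomy V x₀ 0 1) * su2a0 (plaquetteHolonomy V y₀ 0 1) *
        ∏ p : Plaquette 2 L, (U ℝ (x p)).eval (su2a0 (plaquetteHolonomy V p.1 p.2.1.1 p.2.1.2))
        ∂(Measure.pi fun _ : Edge 2 L => haarProbability (Matrix.specialUnitaryGroup (Fin 2) ℂ)) =
      T1 x + T2 x + T3 x + T4 x := by
    intro x
    rw [pair_insertion_term_two β hxy x, hT1, hT2, hT3, hT4, hc]
    simp only
    split_ifs <;> ring
  simp_rw [hT] at hsum hN
  have hprod0 : ∀ x : Plaquette 2 L → ℕ, 0 ≤ ∏ p, c (x p) := fun x => Finset.prod_nonneg fun p _ => hc0 _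
  have hT10 : ∀ x, 0 ≤ T1 x := by
    intro x; rw [hT1]
    refine mul_nonneg (hprod0 x) (mul_nonneg (by norm_num) ?_)
    split_ifs <;> positivity
  have hT20 : ∀ x, 0 ≤ T2 x := by
    intro x; rw [hT2]
    refine mul_nonneg (hprod0 x) (mul_nonneg (by norm_num) ?_)
    split_ifs <;> positivity
  have hT30 : ∀ x, 0 ≤ T3 x := by
    intro x; rw [hT3]
    refine mul_nonneg (hprod0 x) (mul_nonneg (by norm_num) ?_)
    split_ifs <;> positivity
  have hT40 : ∀ x, 0 ≤ T4 x := by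
    intro x; rw [hT4]
    refine mul_nonneg (hprod0 x) (mul_nonneg (by norm_num) ?_)
    split_ifs <;> positivity
  have hT1s : Summable T1 :=
    Summable.of_nonneg_of_le hT10 (fun x => by linarith [hT20 x, hT30 x, hT40 x]) hsum
  have hT2s : Summable T2 :=
    Summable.of_nonneg_of_le hT20 (fun x => by linarith [hT10 x, hT30 x, hT40 x]) hsum
  have hT3s : Summable T3 :=
    Summable.of_nonneg_of_le hT30 (fun x => by linarith [hT10 x, hT20 x, hT40 x]) hsum
  have hT4s : Summable T4 :=
    Summable.of_nonneg_of_le hT40 (fun x => by linarith [hT10 x, hT20 x, hT30 x]) hsum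
  -- the surviving assignments
  set g₁ : ℕ → (Plaquette 2 L → ℕ) := fun n => update (update (fun _ => n + 1) q₀ n) p₀ n with hg₁
  set g₂ : ℕ → (Plaquette 2 L → ℕ) := fun n => update (update (fun _ => n + 1) q₀ n) p₀ (n + 2) with hg₂
  set g₃ : ℕ → (Plaquette 2 L → ℕ) := fun n => update (update (fun _ => n + 1) q₀ (n + 2)) p₀ n with hg₃
  set g₄ : ℕ → (Plaquette 2 L → ℕ) := fun n => update (update (fun _ => n) q₀ (n + 1)) p₀ (n + 1) with hg₄
  have hg₁inj : Injective g₁ := fun n n' h => by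
    have := congrFun h p₀
    simpa [hg₁] using this
  have hg₂inj : Injective g₂ := fun n n' h => by
    have := congrFun h p₀
    simpa [hg₂] using this
  have hg₃inj : Injective g₃ := fun n n' h => by
    have := congrFun h p₀
    simpa [hg₃] using this
  have hg₄inj : Injective g₄ := fun n n' h => by
    have := congrFun h p₀
    simpa [hg₄] using this
  -- plaquettes other than `p₀`, `q₀` have base sites `≠ x₀`, `≠ y₀`
  have hbase : ∀ p : Plaquette 2 L, p ≠ p₀ → p.1 ≠ x₀ := by
    intro p hp h1
    exact hp (by rw [plaquette_two_eq p, h1])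
  have hbase' : ∀ p : Plaquette 2 L, p ≠ q₀ → p.1 ≠ y₀ := by
    intro p hp h1
    exact hp (by rw [plaquette_two_eq p, h1])
  have hyx : y₀ ≠ x₀ := fun h => hxy h.symm
  -- generic support argument: if `update (update m y₀ a) x₀ b` is constant then it is `≡ b`,
  -- `a = b` and `m ≡ b` off `{x₀, y₀}`
  have hconst : ∀ (x : Plaquette 2 L → ℕ) (a b : ℕ),
      (∀ s : Site 2 L, update (update (fun s : Site 2 L => x (s, pl)) y₀ a) x₀ b s =
        update (update (fun s : Site 2 L => x (s, pl)) y₀ a) x₀ b 0) →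
      a = b ∧ ∀ p : Plaquette 2 L, p ≠ p₀ → p ≠ q₀ → x p = b := by
    intro x a b hcst
    have hall : ∀ s, update (update (fun s : Site 2 L => x (s, pl)) y₀ a) x₀ b s = b := by
      intro s
      rw [hcst s, ← hcst x₀, update_self]
    refine ⟨?_, fun p hp hq => ?_⟩
    · have h := hall y₀
      rwa [update_of_ne hyx, update_self] at h
    · have h := hall p.1
      rw [update_of_ne (hbase p hp), update_of_ne (hbase' p hq)] at h
      rw [plaquette_two_eq p]
      exact h
  have hsuppT1 : support T1 ⊆ Set.range g₁ := by
    intro x hx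
    rw [mem_support, hT1] at hx
    simp only at hx
    have hcst : ∀ s : Site 2 L, update (update (fun s : Site 2 L => x (s, pl)) y₀ (x q₀ + 1)) x₀ (x p₀ + 1) s =
        update (update (fun s : Site 2 L => x (s, pl)) y₀ (x q₀ + 1)) x₀ (x p₀ + 1) 0 := by
      by_contra h
      rw [if_neg h, mul_zero, mul_zero] at hx
      exact hx rfl
    obtain ⟨hab, hoff⟩ := hconst x _ _ hcst
    refine ⟨x p₀, funext fun p => ?_⟩
    by_cases hp : p = p₀
    · rw [hp, hg₁]; simp
    · by_cases hq : p = q₀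
      · rw [hq, hg₁]
        simp only [update_of_ne hpq.symm, update_self]
        omega
      · rw [hg₁]
        simp only [update_of_ne hp, update_of_ne hq]
        exact (hoff p hp hq).symm
  have hsuppT2 : support T2 ⊆ Set.range g₂ := by
    intro x hx
    rw [mem_support, hT2] at hx
    simp only at hx
    have h0 : x p₀ ≠ 0 := by
      intro h
      rw [if_pos h, mul_zero, mul_zero] at hx
      exact hx rfl
    rw [if_neg h0] at hx
    have hcst : ∀ s : Site 2 L, update (update (fun s : Site 2 L => x (s, pl)) y₀ (x q₀ + 1)) x₀ (x p₀ - 1) s =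
        update (update (fun s : Site 2 L => x (s, pl)) y₀ (x q₀ + 1)) x₀ (x p₀ - 1) 0 := by
      by_contra h
      rw [if_neg h, mul_zero, mul_zero] at hx
      exact hx rfl
    obtain ⟨hab, hoff⟩ := hconst x _ _ hcst
    refine ⟨x q₀, funext fun p => ?_⟩
    by_cases hp : p = p₀
    · rw [hp, hg₂]
      simp only [update_self]
      omega
    · by_cases hq : p = q₀
      · rw [hq, hg₂]
        simp only [update_of_ne hpq.symm, update_self]
      · rw [hg₂]
        simp only [update_of_ne hp, update_of_ne hq]
        rw [hoff p hp hq]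
        omega
  have hsuppT3 : support T3 ⊆ Set.range g₃ := by
    intro x hx
    rw [mem_support, hT3] at hx
    simp only at hx
    have h0 : x q₀ ≠ 0 := by
      intro h
      rw [if_pos h, mul_zero, mul_zero] at hx
      exact hx rfl
    rw [if_neg h0] at hx
    have hcst : ∀ s : Site 2 L, update (update (fun s : Site 2 L => x (s, pl)) y₀ (x q₀ - 1)) x₀ (x p₀ + 1) s =
        update (update (fun s : Site 2 L => x (s, pl)) y₀ (x q₀ - 1)) x₀ (x p₀ + 1) 0 := by
      by_contra h
      rw [if_neg h, mul_zero, mul_zero] at hx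
      exact hx rfl
    obtain ⟨hab, hoff⟩ := hconst x _ _ hcst
    refine ⟨x p₀, funext fun p => ?_⟩
    by_cases hp : p = p₀
    · rw [hp, hg₃]; simp
    · by_cases hq : p = q₀
      · rw [hq, hg₃]
        simp only [update_of_ne hpq.symm, update_self]
        omega
      · rw [hg₃]
        simp only [update_of_ne hp, update_of_ne hq]
        exact (hoff p hp hq).symm
  have hsuppT4 : support T4 ⊆ Set.range g₄ := by
    intro x hx
    rw [mem_support, hT4] at hx
    simp only at hx
    have h0 : x q₀ ≠ 0 := by
      intro h
      rw [if_pos h, mul_zero, mul_zero] at hx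
      exact hx rfl
    rw [if_neg h0] at hx
    have h0' : x p₀ ≠ 0 := by
      intro h
      rw [if_pos h, mul_zero, mul_zero] at hx
      exact hx rfl
    rw [if_neg h0'] at hx
    have hcst : ∀ s : Site 2 L, update (update (fun s : Site 2 L => x (s, pl)) y₀ (x q₀ - 1)) x₀ (x p₀ - 1) s =
        update (update (fun s : Site 2 L => x (s, pl)) y₀ (x q₀ - 1)) x₀ (x p₀ - 1) 0 := by
      by_contra h
      rw [if_neg h, mul_zero, mul_zero] at hx
      exact hx rfl
    obtain ⟨hab, hoff⟩ := hconst x _ _ hcst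
    refine ⟨x p₀ - 1, funext fun p => ?_⟩
    by_cases hp : p = p₀
    · rw [hp, hg₄]
      simp only [update_self]
      omega
    · by_cases hq : p = q₀
      · rw [hq, hg₄]
        simp only [update_of_ne hpq.symm, update_self]
        omega
      · rw [hg₄]
        simp only [update_of_ne hp, update_of_ne hq]
        rw [hoff p hp hq]
  -- the values on the surviving assignments: the updated base assignments are constant
  have hval : ∀ (n a b u v : ℕ) (g : Plaquette 2 L → ℕ),
      g = update (update (fun _ => n) q₀ u) p₀ v →
      update (update (fun s : Site 2 L => g (s, pl)) y₀ a) x₀ b = fun s =>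
        if s = x₀ then b else if s = y₀ then a else n := by
    intro n a b u v g hg
    funext s
    by_cases hs : s = x₀
    · rw [hs, update_self, if_pos rfl]
    · rw [update_of_ne hs, if_neg hs]
      by_cases hs' : s = y₀
      · rw [hs', update_self, if_pos rfl]
      · rw [update_of_ne hs', if_neg hs', hg]
        have h1 : ((s, pl) : Plaquette 2 L) ≠ p₀ := fun h => hs (congrArg Prod.fst h)
        have h2 : ((s, pl) : Plaquette 2 L) ≠ q₀ := fun h => hs' (congrArg Prod.fst h)
        simp [update_of_ne h1, update_of_ne h2]
  have hconstfun : ∀ k : ℕ, (∀ s : Site 2 L, (fun s : Site 2 L => if s = x₀ then k else if s = y₀ then k else k) s =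
      (fun s : Site 2 L => if s = x₀ then k else if s = y₀ then k else k) 0) ∧
      (fun s : Site 2 L => if s = x₀ then k else if s = y₀ then k else k) 0 = k := by
    intro k
    refine ⟨fun s => ?_, ?_⟩ <;> simp
  have hT1g : ∀ n : ℕ, T1 (g₁ n) = (1 / 4) * (c n ^ 2 * c (n + 1) ^ (L ^ 2 - 2) *
      ((((n : ℝ) + 1 + 1) ^ (L ^ 2)))⁻¹) := by
    intro n
    rw [hT1]
    simp only
    have hp0 : g₁ n p₀ = n := by rw [hg₁]; simp
    have hq0 : g₁ n q₀ = n := by rw [hg₁]; simp [update_of_ne hpq.symm]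
    rw [hp0, hq0, hval (n + 1) (n + 1) (n + 1) n n (g₁ n) (by rw [hg₁]),
      if_pos (hconstfun (n + 1)).1, (hconstfun (n + 1)).2, hg₁, prod_update_update_const c hpq]
    push_cast
    ring
  have hT2g : ∀ n : ℕ, T2 (g₂ n) = (1 / 4) * (c n * c (n + 2) * c (n + 1) ^ (L ^ 2 - 2) *
      ((((n : ℝ) + 1 + 1) ^ (L ^ 2)))⁻¹) := by
    intro n
    rw [hT2]
    simp only
    have hp0 : g₂ n p₀ = n + 2 := by rw [hg₂]; simp
    have hq0 : g₂ n q₀ = n := by rw [hg₂]; simp [update_of_ne hpq.symm]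
    rw [hp0, hq0, if_neg (by omega : n + 2 ≠ 0), show n + 2 - 1 = n + 1 by omega,
      hval (n + 1) (n + 1) (n + 1) n (n + 2) (g₂ n) (by rw [hg₂]),
      if_pos (hconstfun (n + 1)).1, (hconstfun (n + 1)).2, hg₂, prod_update_update_const c hpq]
    push_cast
    ring
  have hT3g : ∀ n : ℕ, T3 (g₃ n) = (1 / 4) * (c n * c (n + 2) * c (n + 1) ^ (L ^ 2 - 2) *
      ((((n : ℝ) + 1 + 1) ^ (L ^ 2)))⁻¹) := by
    intro n
    rw [hT3]
    simp only
    have hp0 : g₃ n p₀ = n := by rw [hg₃]; simp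
    have hq0 : g₃ n q₀ = n + 2 := by rw [hg₃]; simp [update_of_ne hpq.symm]
    rw [hp0, hq0, if_neg (by omega : n + 2 ≠ 0), show n + 2 - 1 = n + 1 by omega,
      hval (n + 1) (n + 1) (n + 1) (n + 2) n (g₃ n) (by rw [hg₃]),
      if_pos (hconstfun (n + 1)).1, (hconstfun (n + 1)).2, hg₃, prod_update_update_const c hpq]
    push_cast
    ring
  have hT4g : ∀ n : ℕ, T4 (g₄ n) = (1 / 4) * (c (n + 1) ^ 2 * c n ^ (L ^ 2 - 2) *
      ((((n : ℝ) + 1) ^ (L ^ 2)))⁻¹) := by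
    intro n
    rw [hT4]
    simp only
    have hp0 : g₄ n p₀ = n + 1 := by rw [hg₄]; simp
    have hq0 : g₄ n q₀ = n + 1 := by rw [hg₄]; simp [update_of_ne hpq.symm]
    rw [hp0, hq0, if_neg (by omega : n + 1 ≠ 0), if_neg (by omega : n + 1 ≠ 0), Nat.add_sub_cancel,
      hval n n n (n + 1) (n + 1) (g₄ n) (by rw [hg₄]),
      if_pos (hconstfun n).1, (hconstfun n).2, hg₄, prod_update_update_const c hpq]
    ring
  -- assemble
  have h1 : HasSum (T1 ∘ g₁) (∑' x, T1 x) := by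
    rw [← hg₁inj.tsum_eq hsuppT1]
    exact (hT1s.comp_injective hg₁inj).hasSum
  have h2 : HasSum (T2 ∘ g₂) (∑' x, T2 x) := by
    rw [← hg₂inj.tsum_eq hsuppT2]
    exact (hT2s.comp_injective hg₂inj).hasSum
  have h3 : HasSum (T3 ∘ g₃) (∑' x, T3 x) := by
    rw [← hg₃inj.tsum_eq hsuppT3]
    exact (hT3s.comp_injective hg₃inj).hasSum
  have h4 : HasSum (T4 ∘ g₄) (∑' x, T4 x) := by
    rw [← hg₄inj.tsum_eq hsuppT4]
    exact (hT4s.comp_injective hg₄inj).hasSum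
  have h1234 := ((h1.add h2).add h3).add h4
  rw [← hT1s.tsum_add hT2s, ← (hT1s.add hT2s).tsum_add hT3s, ← ((hT1s.add hT2s).add hT3s).tsum_add hT4s,
    ← hN] at h1234
  refine h1234.congr_fun fun n => ?_
  simp only [Function.comp_apply, hT1g, hT2g, hT3g, hT4g, hc]
  ring

end Summit.Ventures.LatticeQCDFlow.Scoring
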